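import Summits.CriticalPhenomena.PercolationContinuityZ3.Theorems.Transplant.SkelFrmQuasi1ReachHoldsQ3VPx
import Summits.CriticalPhenomena.PercolationContinuityZ3.Theorems.Transplant.PlanarSkeletonFrmQuasiDefs
import Summits.CriticalPhenomena.PercolationContinuityZ3.Theorems.Transplant.SkelFrmQuasi1SlotTypes
import HarnessLib

/-!
# GEN-Q PORT (WAVE-Q table v0.8 section 2, row G281, U-level L?; captain R-6/R-7 2026-08-27: carrier token swap `PlanarSkeletonFrmFrom ↦ PlanarSkeletonFrmQuasi`)
# of the tree module «Transplant/SkelFrmFrom1ReachHoldsQ3VNodePx» (sha256 f76c103468de24db…) onto the quasi-step carrier `PlanarSkeletonFrmQuasi` (p507026): «SkelFrmQuasi1ReachHoldsQ3VNodePx»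

DEDUP GUARD (stmt-g34, L-stmt34-2): the statement spells the carrier-qualified heads `PlanarSkeletonFrmQuasi.ReachHoldsRHNQFnLKPxAt` / `PlanarSkeletonFrmQuasi.frmChoiceAllQ3VPx` so the header text differs from «SkelFrmFrom1ReachHoldsQ3VNodePx» (the gate's textual `dedup.landed` bounced gen-1's ZoneKPx p539450 on exactly this); the elaborated statement is unchanged. TOP G281 (tool ONLY): waits «SkelFrmQuasi1ReachHoldsQ3VPx»-Q; no hunk of its own expected beyond the callee rename.

ORIGINAL TITLE: 

builds on p205010 (kernel theorem, internal audit signed; external expert review pending) — nothing in this file uses p205010; NOTHING is claimed about any open node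
((N3-b), the end state).  Lane `prim-bschramm`, seat `prim-bschramm-stmt` (gen 33; GEN-Q column pen; tool = captain gen-1 g4's port_genq.py R-14 --cone + p3-g30's T1 patch).  Helper file (`--supports stmt-CriticalPhenomena-4575 --as helper`).
PORT RULES (U-wave r1–r4 re-used, GEN-Q hunk classes of p3-g29 #6136): declaration order, names and proof texts are those of «SkelFrmFrom1ReachHoldsQ3VNodePx», byte-identical except
(i) the carrier token `PlanarSkeletonFrmFrom ↦ PlanarSkeletonFrmQuasi` in binders, `namespace`/`end` lines and qualified names (module names `SkelFrmFrom… ↦ SkelFrmQuasi…`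
in imports of already-ported rows); (ii) `Φ.step ↦ Φ.qstep` with the called Steps lemma replaced by its `…Q`/`_q` twin and the cost `Φ.M` threaded (none in this file unless
listed below); (iii) `Φ.cyl_connected ↦ Φ.cyl_reach` readers (none unless listed); (iv) graph-ball radii / window floors ×`Φ.M` (none unless listed).  Carrier-free
residents stay imported/exported from the original «SkelFrm1ReachHoldsQ3VNodePx» exactly as in the FrmFrom port.  Docstrings and citations are the original's.

-/

open scoped Classical

noncomputable section

namespace Summit.CriticalPhenomena.PercolationContinuityZ3.Theorems.Transplant

namespace PlanarSkeletonFrmQuasi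

open Literature.Probability.Percolation Literature.Probability.LatticeModels SimpleGraph
open SkelConc (Consts)

/-- **THE (C) COLUMN TARGET OF RECORD UNDER PROXIES AT THE TUPLE Px OF RECORD** (K-floor `Kmin ≥ 160` as a parameter — the Us-4 node takes `Kmin := 480`; served-region kit
index `0`, kit / corridor at the raised index `KS.RK t Dr 0 + D`; window `BSlot.small3`, cells `cvPx D` / `hvPx D`): for every proxy radius `D`,
`ReachHoldsRHNQFnLKPxAt LfQ Kmin (frmChoiceAllQ3VPx D (gvPx D) (fvPx D) (PvPx D) (SUS (exPx D) (mxPx D)) (cvPx D) (hvPx D) BSlot.small3)`.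
[cite: KozmaNitzan2024, §4 Lemma 12 (pp. 23–25), p. 30 (Step IV)] -/
theorem reachHoldsRHNQFnLKPxAt_frmChoiceAllQ3VPx_node (D Kmin : ℕ) (hKmin : 160 ≤ Kmin) :
    PlanarSkeletonFrmQuasi.ReachHoldsRHNQFnLKPxAt NegB.LfQ Kmin
      (PlanarSkeletonFrmQuasi.frmChoiceAllQ3VPx D (NegB.gvPx D) (NegB.fvPx D) (NegB.PvPx D) (NegB.SUS (NegB.exPx D) (NegB.mxPx D)) (NegB.cvPx D) (NegB.hvPx D) NegB.BSlot.small3) :=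
  reachHoldsRHNQFnLKPxAt_frmChoiceAllQ3VPx_of_le D Kmin hKmin
    (fun _ _ _ _ _ _ _ t _ Dr => NegB.Hg_Q (NegB.KS.RK t Dr 0 + D) (NegB.gxR0 (NegB.KS.RK t Dr 0 + D)) (NegB.fxR (NegB.KS.RK t Dr 0 + D)) Dr)
    (fun κ _ _ _ _ _ Φ t p Dr g f =>
      ⟨(NegB.exRD_floors κ Φ t p Dr (NegB.KS.RK t Dr 0 + D) D g f
          (NegB.le_exQ (NegB.KS.RK t Dr 0 + D) (NegB.exRD (NegB.KS.RK t Dr 0 + D) D) κ Φ t p Dr g f).2.2.2.2).2.1,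
        (NegB.le_exQ (NegB.KS.RK t Dr 0 + D) (NegB.exRD (NegB.KS.RK t Dr 0 + D) D) κ Φ t p Dr g f).2.1⟩)
    (fun κ _ _ _ _ _ Φ t p Dr g f =>
      ⟨(NegB.exRD_floors κ Φ t p Dr (NegB.KS.RK t Dr 0 + D) D g f
          (NegB.le_exQ (NegB.KS.RK t Dr 0 + D) (NegB.exRD (NegB.KS.RK t Dr 0 + D) D) κ Φ t p Dr g f).2.2.2.2).2.1,
        (NegB.le_exQ (NegB.KS.RK t Dr 0 + D) (NegB.exRD (NegB.KS.RK t Dr 0 + D) D) κ Φ t p Dr g f).2.2.1⟩)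

end PlanarSkeletonFrmQuasi

end Summit.CriticalPhenomena.PercolationContinuityZ3.Theorems.Transplant

end
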